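import Summits.QuantumFields.YangMills.Theorems.LuscherReductionTwistedTraceScalingTubeBOPackage
import Summits.QuantumFields.YangMills.Theorems.LuscherReductionTwistedTraceScalingRecordWeight
import HarnessLib

/-!
# R27 (crux `TwistedTraceScaling`, stmt-QuantumFields-20203): lane A g12's tube min–max statement `SoftTubeNoIntruderAt L χ` (p621021) is EQUIVALENT to
# `InnerNoIntruderOneOrbitAt L δ` for every admissible nonnegative weight supported in the inner region — in particular for the weight of record
# `recordWeight L δ δg` (p621963) at EVERY gauge width `δg`: the width `t` of C4-CORE's `(s, t)` carries no content; the `s`-window is INNER's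

Standing disprover `ym-cdisprove-20203-1` (gen 22), sequel to `…Negative.InnerBOPackageIffInner` (R18) and `…Negative.OrthoTubeKineticCross` (R26); companion file
`…Negative.TubePackageIffInner` (R27b: the tube package `SoftTubeBOPackageAt` and the hard tubes `TubeNoIntruderAt`).
VETTED (exact, nothing to refute): lane A's ★★★ `innerNoIntruderOneOrbitAt_of_softTube`, `softTubeAdmissible_recordWeight`, `innerNoIntruderOneOrbitAt_pow_of_recordWeight`
(COARSE-DESIGN §23.4–§23.6; HANDOFF-g12 «disprover targets: the typed interfaces `SoftTubeNoIntruderAt L (recordWeight …)` …; (s,t) windows?»).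
FINDING (kernel-checked).  The CONVERSE holds, so the typed C4-CORE interface is, AS TYPED, a costume of INNER one-orbit (R18-type):
* §3 ★ `tubeForm_eq_qform_gaugeAvg`: for every bounded measurable `f` (no invariance, no support condition) `∫∫ f K̃_β f = ⟨Pf, K_β Pf⟩`, `P = gaugeAvg` — the averaged
  kernel is BI-invariant (`K̃_β = P K_β P` as forms); the tube form sees only the invariant part of a test function.
* §4 ★ `l2_gaugeAvg_le_tubeNormSq`: `χ ≥ 0`, `χ ≥ m > 0` on its support, `f` supported in `supp χ` ⇒ `‖Pf‖² ≤ ∫ f²·(N/χ)` (`N = gaugeAvg χ`): pointwise weighted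
  Cauchy–Schwarz on the gauge group (§1, discriminant form) plus `∫ (Pq)·N = ∫ q·N` for the invariant `N`.  Equality iff `f ∝ χ·(invariant)`, i.e. exactly on lane A's
  slice functions `sliceFn χ ψ`: the slice MINIMISES the tube norm at fixed invariant part, so tube Rayleigh quotients are bounded below by invariant ones.
* §5 ★★ `softTubeNoIntruderAt_of_inner`: `InnerNoIntruderOneOrbitAt L δ → SoftTubeNoIntruderAt L χ` for every `χ` measurable, bounded, `≥ 0`, bounded below on its
  support, eventually supported in `{orbitDist < δ β}` (INNER applied to the invariant family `P fᵢ`; a degenerate invariant Gram matrix yields a combination with `Pf_a = 0`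
  a.e., hence tube form `0 ≤` RHS).
* §6 ★★ BY NAME: `softTubeNoIntruderAt_iff_inner`; `softTube_recordWeight_iff_inner (hδ : ∀ β, 0 < δ β) (δg) : SoftTubeNoIntruderAt L (recordWeight L δ δg) ↔
  InnerNoIntruderOneOrbitAt L δ`; `softTube_recordWeight_pow_iff (s t)`; ★ WIDTH IRRELEVANCE `softTube_recordWeight_width_irrel (δg δg')`, `…_pow_width_irrel (s t t')`.
READING for lane A / OWNER / LEAD (paper; the kernel part is §3–§6).  Answer to HANDOFF-g12 «(s,t) windows?»: there is NO `t`-window — for every `δg` whatsoever the typed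
statement at `recordWeight L (powScale s) (powScale t)` is INNER at `powScale s`; the `s`-window is INNER's (door `s < 2/51` feeds COARSE-UPPER, R16/R18; CORE bookkeeping
`s ∈ (1/6, 1/5)`, R25).  The Gaussian gauge factor, the fat-tube cut at `2δ` and the FP normalisation `N` cancel identically between tube form and tube norm once the test
function is optimised over its non-invariant part; `t` is purely METHODOLOGICAL (which test functions a BO proof finds convenient), never a hypothesis a disprover could attack.
Hence neither «is `N` constant to `o(λ_b)` on fatTube» nor «η-dependence of `avgKernel` at `δg`» is a truth condition of a typed text: `avgKernel` is bi-invariant (§3) and `N`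
enters only through `N/χ`, dominated by the invariant norm with equality on slices (§4).  What WOULD be a typed target with a truth set different from INNER's: a min–max
statement for `K̃_β` restricted to PRODUCT test functions `(slow amplitude on the constant-mode tube) ⊗ (fixed gauge Gaussian of width δg) ⊗ (stiff ground state)` with `σ, b, θ`
NAMED — there R21 (uniform `b` fails for `p < 1/6`), R26 (Coriolis cross term) and R25 (window) bite.  NO KILL: INNER one-orbit at `powScale s`, `s ∈ (1/6,1/5)` (fixed `L`,
eventually in β) remains plausible on paper; this file changes no verdict.
HONEST FRAMING: structural lemmas about the typed interface of a stub lane (S-BASE C4-CORE) of a child of the CONDITIONAL reduction route (femto rung R2b1); not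
`¬TwistedTraceScaling`, not infinite volume, not a gap, not Clay.  Sorry-free, no new definition; axioms ⊆ {propext, Classical.choice, Quot.sound}.

## References
* M. Lüscher, Nucl. Phys. B219 (1983) 233, §3 (gauge fixing on the torus; Born–Oppenheimer reduction to the constant modes). [Luscher1983]
* E. Seiler, LNP 159 (1982), §2–3 (gauge averaging, transfer matrix positivity, Faddeev–Popov slices on the lattice). [SeilerLNP1982]
-/


set_option autoImplicit false

noncomputable section

open MeasureTheory Filter Topology Real
open scoped BigOperators
open Literature.MathematicalPhysics.QuantumFieldTheory hiding SU2
open Literature.MathematicalPhysics.QuantumLattice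
open Summit.QuantumFields.YangMills.Theorems.FemtoTransferGap
open Summit.QuantumFields.YangMills.Theorems.FemtoTransferGap.TwoLattice.Avg

namespace Summit.QuantumFields.YangMills.Theorems.TwistedTraceScaling.Negative.R27

/-! ## §1 A weighted Cauchy–Schwarz inequality (discriminant form) -/

section CS

variable {Ω : Type*}

/-- `|a²/c| ≤ A²/m` when `|a| ≤ A` and `c ≥ m > 0` wherever `a ≠ 0` (Lean's `x/0 = 0` covers the rest). [folklore] -/
theorem abs_sq_div_le {a c : Ω → ℝ} {A m : ℝ} (hA : ∀ ω, |a ω| ≤ A) (hm : 0 < m) (hsupp : ∀ ω, a ω ≠ 0 → m ≤ c ω) (ω : Ω) :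
    |a ω ^ 2 / c ω| ≤ A ^ 2 / m := by
  by_cases h : a ω = 0
  · rw [h, zero_pow two_ne_zero, zero_div, abs_zero]
    exact div_nonneg (sq_nonneg A) hm.le
  · have hcm := hsupp ω h
    have hc : 0 < c ω := hm.trans_le hcm
    rw [abs_div, abs_of_pos hc, abs_pow]
    have h1 : |a ω| ^ 2 ≤ A ^ 2 := pow_le_pow_left₀ (abs_nonneg _) (hA ω) 2
    calc |a ω| ^ 2 / c ω ≤ A ^ 2 / c ω := div_le_div_of_nonneg_right h1 hc.le
      _ ≤ A ^ 2 / m := div_le_div_of_nonneg_left (sq_nonneg A) hm hcm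

variable [MeasurableSpace Ω] (ν : Measure Ω) [IsFiniteMeasure ν]

/-- **Weighted Cauchy–Schwarz**: `(∫ a)² ≤ (∫ c)·(∫ a²/c)` for bounded measurable `a, c` with `c ≥ 0` and `c ≥ m > 0` on `supp a` (the quadratic
`t ↦ ∫ (a − tc)²/c ≥ 0` has nonpositive discriminant). [folklore] -/
theorem sq_integral_le_mul_integral_sq_div {a c : Ω → ℝ} (ha : Measurable a) (hc : Measurable c) {A Cc m : ℝ}
    (hA : ∀ ω, |a ω| ≤ A) (hCc : ∀ ω, |c ω| ≤ Cc) (hc0 : ∀ ω, 0 ≤ c ω) (hm : 0 < m) (hsupp : ∀ ω, a ω ≠ 0 → m ≤ c ω) :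
    (∫ ω, a ω ∂ν) ^ 2 ≤ (∫ ω, c ω ∂ν) * ∫ ω, a ω ^ 2 / c ω ∂ν := by
  have hia : Integrable a ν := integrable_of_measurable_abs_le ν ha hA
  have hic : Integrable c ν := integrable_of_measurable_abs_le ν hc hCc
  have hiq : Integrable (fun ω => a ω ^ 2 / c ω) ν :=
    integrable_of_measurable_abs_le ν ((ha.pow_const 2).div hc) (abs_sq_div_le hA hm hsupp)
  have hpt : ∀ (t : ℝ) (ω : Ω), (a ω - t * c ω) ^ 2 / c ω = a ω ^ 2 / c ω - 2 * t * a ω + t ^ 2 * c ω := by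
    intro t ω
    by_cases h : c ω = 0
    · have ha0 : a ω = 0 := by
        by_contra h'
        have h2 := hsupp ω h'
        rw [h] at h2
        exact absurd h2 (not_le.mpr hm)
      rw [h, ha0]; ring
    · field_simp
      ring
  have hquad : ∀ t : ℝ, 0 ≤ (∫ ω, c ω ∂ν) * (t * t) + (-(2 * ∫ ω, a ω ∂ν)) * t + ∫ ω, a ω ^ 2 / c ω ∂ν := by
    intro t
    have h0 : 0 ≤ ∫ ω, (a ω - t * c ω) ^ 2 / c ω ∂ν := integral_nonneg fun ω => div_nonneg (sq_nonneg _) (hc0 ω)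
    have e : (fun ω => (a ω - t * c ω) ^ 2 / c ω) = fun ω => (a ω ^ 2 / c ω - 2 * t * a ω) + t ^ 2 * c ω := by
      funext ω; rw [hpt t ω]
    have hi1 : Integrable (fun ω => a ω ^ 2 / c ω - 2 * t * a ω) ν := hiq.sub (hia.const_mul (2 * t))
    have hi2 : Integrable (fun ω => t ^ 2 * c ω) ν := hic.const_mul (t ^ 2)
    have hi3 : Integrable (fun ω => 2 * t * a ω) ν := hia.const_mul (2 * t)
    have h1 : ∫ ω, (a ω - t * c ω) ^ 2 / c ω ∂ν = (∫ ω, a ω ^ 2 / c ω ∂ν) - 2 * t * ∫ ω, a ω ∂ν + t ^ 2 * ∫ ω, c ω ∂ν := by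
      rw [e, integral_add hi1 hi2, integral_sub hiq hi3, integral_const_mul, integral_const_mul]
    have e2 : (∫ ω, c ω ∂ν) * (t * t) + (-(2 * ∫ ω, a ω ∂ν)) * t + ∫ ω, a ω ^ 2 / c ω ∂ν =
        (∫ ω, a ω ^ 2 / c ω ∂ν) - 2 * t * ∫ ω, a ω ∂ν + t ^ 2 * ∫ ω, c ω ∂ν := by ring
    rw [e2, ← h1]
    exact h0
  have hd := discrim_le_zero hquad
  have e3 : discrim (∫ ω, c ω ∂ν) (-(2 * ∫ ω, a ω ∂ν)) (∫ ω, a ω ^ 2 / c ω ∂ν) =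
      4 * ((∫ ω, a ω ∂ν) ^ 2 - (∫ ω, c ω ∂ν) * ∫ ω, a ω ^ 2 / c ω ∂ν) := by
    rw [discrim]; ring
  rw [e3] at hd
  linarith

end CS

variable {L : ℕ} [NeZero L]

/-! ## §2 Gauge averages of finite combinations and of functions vanishing on an orbit -/

/-- The gauge average is linear over finite combinations of bounded measurable functions. [folklore] -/
theorem gaugeAvg_combination {k : ℕ} {f : Fin k → GaugeConfig 3 L SU2 → ℝ} (hfm : ∀ i, Measurable (f i))
    (hfb : ∀ i, ∃ C : ℝ, ∀ U, |f i U| ≤ C) (a : Fin k → ℝ) (U : GaugeConfig 3 L SU2) :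
    gaugeAvg (fun V => ∑ i, a i * f i V) U = ∑ i, a i * gaugeAvg (f i) U := by
  have hint : ∀ i, Integrable (fun g : Site 3 L → SU2 => a i * f i (gaugeTransform g U)) (gaugeMeasure L) := fun i => by
    obtain ⟨C, hC⟩ := hfb i
    exact (integrable_of_measurable_abs_le _ (measurable_comp_gaugeTransform_left (hfm i) U) fun g => hC _).const_mul (a i)
  unfold gaugeAvg
  rw [integral_finsetSum Finset.univ fun i _ => hint i]
  exact Finset.sum_congr rfl fun i _ => integral_const_mul (a i) _

/-- A function vanishing on the whole gauge orbit of `U` has gauge average `0` at `U`. [folklore] -/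
theorem gaugeAvg_eq_zero_of_forall {f : GaugeConfig 3 L SU2 → ℝ} {U : GaugeConfig 3 L SU2}
    (h : ∀ g : Site 3 L → SU2, f (gaugeTransform g U) = 0) : gaugeAvg f U = 0 := by
  unfold gaugeAvg
  simp only [h, integral_zero]

/-! ## §3 ★ The tube form is the transfer form of the gauge average -/

/-- ★ **`∫∫ f K̃_β f = ⟨Pf, K_β Pf⟩`** (`P = gaugeAvg`) for every bounded measurable `f`: the averaged kernel is bi-invariant, so the tube form only sees the
invariant part of a test function. [cite: SeilerLNP1982, §3] -/
theorem tubeForm_eq_qform_gaugeAvg (β : ℝ) {f : GaugeConfig 3 L SU2 → ℝ} (hf : Measurable f) {C : ℝ} (hC : ∀ U, |f U| ≤ C) :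
    tubeForm β f = qform su2Rep β (gaugeAvg f) (gaugeAvg f) := by
  haveI : SecondCountableTopology SU2 := secondCountableTopology_su2
  obtain ⟨M, hM⟩ := exists_transferKernel_le su2Rep continuous_su2Rep β (L := L)
  have hPm : Measurable (gaugeAvg f) := measurable_gaugeAvg hf
  have hPb : ∀ U, |gaugeAvg f U| ≤ C := abs_gaugeAvg_le hf hC
  have hPinv : ∀ (g : Site 3 L → SU2) (U : GaugeConfig 3 L SU2), gaugeAvg f (gaugeTransform g U) = gaugeAvg f U :=
    fun g U => gaugeAvg_gaugeTransform f g U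
  have hFm : Measurable (transferApply β (gaugeAvg f)) := measurable_transferApply β hPm
  have hFb : ∀ U, |transferApply β (gaugeAvg f) U| ≤ M * C := abs_transferApply_le β hM hPm hPb
  have hFinv := transferApply_gaugeTransform_of_invariant β hPm hPinv
  calc tubeForm β f = ∫ U, f U * gaugeAvg (transferApply β f) U ∂configMeasure SU2 L := by
        unfold tubeForm
        refine integral_congr_ae (ae_of_all _ fun U => ?_)
        dsimp only
        rw [gaugeAvg_transferApply_eq_integral_avgKernel β hf hC, ← integral_const_mul]
        refine integral_congr_ae (ae_of_all _ fun V => ?_)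
        dsimp only
        ring
    _ = ∫ U, transferApply β (gaugeAvg f) U * f U ∂configMeasure SU2 L := by
        refine integral_congr_ae (ae_of_all _ fun U => ?_)
        dsimp only
        rw [← transferApply_gaugeAvg β hf hC, mul_comm]
    _ = ∫ U, transferApply β (gaugeAvg f) U * gaugeAvg f U ∂configMeasure SU2 L :=
        (integral_invariant_mul_gaugeAvg hf hC hFm hFb hFinv).symm
    _ = qform su2Rep β (gaugeAvg f) (gaugeAvg f) := by
        rw [qform_eq_l2_transferApply]
        unfold l2
        refine integral_congr_ae (ae_of_all _ fun U => ?_)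
        dsimp only
        rw [mul_comm]

/-! ## §4 ★ The tube norm dominates the invariant norm -/

/-- ★ **`‖Pf‖² ≤ ∫ f²·(N/χ)`** for `χ ≥ 0` measurable bounded with `χ ≥ m > 0` on its support and `f` bounded measurable supported in `supp χ`
(pointwise weighted Cauchy–Schwarz on the gauge group, then `∫ (P q)·N = ∫ q·N` for the invariant `N = gaugeAvg χ`).  Equality holds on slice functions
`f = sliceFn χ ψ`. [cite: SeilerLNP1982, §2] -/
theorem l2_gaugeAvg_le_tubeNormSq {χ f : GaugeConfig 3 L SU2 → ℝ} (hχm : Measurable χ) {Cχ : ℝ} (hCχ : ∀ U, |χ U| ≤ Cχ)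
    (hχ0 : ∀ U, 0 ≤ χ U) {m : ℝ} (hm : 0 < m) (hχlow : ∀ U, χ U ≠ 0 → m ≤ χ U)
    (hf : Measurable f) {C : ℝ} (hC : ∀ U, |f U| ≤ C) (hfs : ∀ U, f U ≠ 0 → χ U ≠ 0) :
    l2 (gaugeAvg f) (gaugeAvg f) ≤ tubeNormSq (softWeight χ) f := by
  have hlow' : ∀ U, f U ≠ 0 → m ≤ χ U := fun U hU => hχlow U (hfs U hU)
  -- pointwise weighted Cauchy–Schwarz on the gauge group
  have hpt : ∀ U, gaugeAvg f U * gaugeAvg f U ≤ gaugeAvg (fun V => f V ^ 2 / χ V) U * gaugeAvg χ U := fun U => by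
    have h := sq_integral_le_mul_integral_sq_div (gaugeMeasure L) (measurable_comp_gaugeTransform_left hf U)
      (measurable_comp_gaugeTransform_left hχm U) (fun g => hC _) (fun g => hCχ _) (fun g => hχ0 _) hm fun g hg => hlow' _ hg
    rw [sq, mul_comm (∫ g, χ (gaugeTransform g U) ∂gaugeMeasure L)] at h
    exact h
  have hqm : Measurable fun V => f V ^ 2 / χ V := (hf.pow_const 2).div hχm
  have hqb : ∀ V, |f V ^ 2 / χ V| ≤ C ^ 2 / m := abs_sq_div_le hC hm hlow'
  have hNm : Measurable (gaugeAvg χ) := measurable_gaugeAvg hχm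
  have hNb : ∀ U, |gaugeAvg χ U| ≤ Cχ := abs_gaugeAvg_le hχm hCχ
  have hNinv : ∀ (g : Site 3 L → SU2) (U : GaugeConfig 3 L SU2), gaugeAvg χ (gaugeTransform g U) = gaugeAvg χ U :=
    fun g U => gaugeAvg_gaugeTransform χ g U
  have hPm : Measurable (gaugeAvg f) := measurable_gaugeAvg hf
  have hPb : ∀ U, |gaugeAvg f U| ≤ C := abs_gaugeAvg_le hf hC
  have hQm : Measurable (gaugeAvg fun V => f V ^ 2 / χ V) := measurable_gaugeAvg hqm
  have hQb : ∀ U, |gaugeAvg (fun V => f V ^ 2 / χ V) U| ≤ C ^ 2 / m := abs_gaugeAvg_le hqm hqb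
  have hi1 : Integrable (fun U => gaugeAvg f U * gaugeAvg f U) (configMeasure SU2 L) :=
    integrable_of_measurable_abs_le _ (hPm.mul hPm) (C := C * C) fun U => by
      rw [abs_mul]; exact mul_le_mul (hPb U) (hPb U) (abs_nonneg _) ((abs_nonneg _).trans (hPb U))
  have hi2 : Integrable (fun U => gaugeAvg (fun V => f V ^ 2 / χ V) U * gaugeAvg χ U) (configMeasure SU2 L) :=
    integrable_of_measurable_abs_le _ (hQm.mul hNm) (C := C ^ 2 / m * Cχ) fun U => by
      rw [abs_mul]; exact mul_le_mul (hQb U) (hNb U) (abs_nonneg _) ((abs_nonneg _).trans (hQb U))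
  calc l2 (gaugeAvg f) (gaugeAvg f) = ∫ U, gaugeAvg f U * gaugeAvg f U ∂configMeasure SU2 L := rfl
    _ ≤ ∫ U, gaugeAvg (fun V => f V ^ 2 / χ V) U * gaugeAvg χ U ∂configMeasure SU2 L := integral_mono hi1 hi2 fun U => hpt U
    _ = ∫ U, f U ^ 2 / χ U * gaugeAvg χ U ∂configMeasure SU2 L := integral_gaugeAvg_mul_invariant hqm hqb hNm hNb hNinv
    _ = tubeNormSq (softWeight χ) f := by
        unfold tubeNormSq softWeight
        refine integral_congr_ae (ae_of_all _ fun U => ?_)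
        dsimp only
        ring

/-! ## §5 ★★ INNER one-orbit implies the soft tube statement -/

/-- ★★ **`InnerNoIntruderOneOrbitAt L δ → SoftTubeNoIntruderAt L χ`** for every weight `χ` that is measurable, bounded, nonnegative, bounded below on its support
and eventually supported in the inner region `{orbitDist < δ β}`: apply INNER to the invariant family `gaugeAvg fᵢ` (§3: same form; §4: smaller norm); a
combination with degenerate invariant norm has `gaugeAvg f_a = 0` a.e. and tube form `0`. [cite: Luscher1983, §3] [cite: SeilerLNP1982, §2–3] -/
theorem softTubeNoIntruderAt_of_inner {δ : ℝ → ℝ} {χ : ℝ → GaugeConfig 3 L SU2 → ℝ}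
    (hχm : ∀ β, Measurable (χ β)) (hχb : ∀ β, ∃ C : ℝ, ∀ U, |χ β U| ≤ C) (hχ0 : ∀ β U, 0 ≤ χ β U)
    (hχlow : ∀ β, ∃ m : ℝ, 0 < m ∧ ∀ U, χ β U ≠ 0 → m ≤ χ β U)
    (hχs : ∃ β1 : ℝ, ∀ β : ℝ, β1 ≤ β → ∀ U, χ β U ≠ 0 → orbitDist U < δ β)
    (hI : InnerNoIntruderOneOrbitAt L δ) : SoftTubeNoIntruderAt L χ := by
  intro k ε hε
  obtain ⟨β0, hβ0⟩ := hI k ε hε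
  obtain ⟨β1, hβ1⟩ := hχs
  refine ⟨max (max β0 β1) 0, fun β hβ f hfm hfb hfs hGram => ?_⟩
  have hβ0' : β0 ≤ β := ((le_max_left _ _).trans (le_max_left _ _)).trans hβ
  have hβ1' : β1 ≤ β := ((le_max_right _ _).trans (le_max_left _ _)).trans hβ
  have hβpos : 0 ≤ β := (le_max_right _ _).trans hβ
  have hsβ : ∀ U, χ β U ≠ 0 → orbitDist U < δ β := hβ1 β hβ1'
  obtain ⟨Cχ, hCχ⟩ := hχb β
  obtain ⟨m, hm, hmχ⟩ := hχlow β
  -- the invariant family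
  set G : Fin (k + 1) → GaugeConfig 3 L SU2 → ℝ := fun i => gaugeAvg (f i) with hG
  have hGm : ∀ i, Measurable (G i) := fun i => measurable_gaugeAvg (hfm i)
  have hGb : ∀ i, ∃ C : ℝ, ∀ U, |G i U| ≤ C := fun i => by
    obtain ⟨C, hC⟩ := hfb i
    exact ⟨C, abs_gaugeAvg_le (hfm i) hC⟩
  have hGinv : ∀ i (g : Site 3 L → SU2) (U : GaugeConfig 3 L SU2), G i (gaugeTransform g U) = G i U :=
    fun i g U => gaugeAvg_gaugeTransform (f i) g U
  have hGs : ∀ i U, G i U ≠ 0 → orbitDist U < δ β := fun i U hU => by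
    by_contra hnot
    have hzero : ∀ g : Site 3 L → SU2, f i (gaugeTransform g U) = 0 := fun g => by
      by_contra h
      have h1 := hsβ _ (hfs i _ h)
      rw [orbitDist_gaugeTransform] at h1
      exact hnot h1
    exact hU (gaugeAvg_eq_zero_of_forall hzero)
  -- combinations: the gauge average of `f_a` is `G_a`
  have hcomb : ∀ a : Fin (k + 1) → ℝ, gaugeAvg (fun V => ∑ i, a i * f i V) = fun U => ∑ i, a i * G i U :=
    fun a => funext fun U => gaugeAvg_combination hfm hfb a U
  have hfs' : ∀ (a : Fin (k + 1) → ℝ) (U : GaugeConfig 3 L SU2), (∑ i, a i * f i U) ≠ 0 → χ β U ≠ 0 := fun a U hU => by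
    obtain ⟨i, hi⟩ := exists_ne_zero_of_combination_ne_zero hU
    exact hfs i U hi
  have hform : ∀ a : Fin (k + 1) → ℝ,
      (∫ U, ∫ V, (∑ i, a i * f i U) * avgKernel β U V * (∑ i, a i * f i V) ∂configMeasure SU2 L ∂configMeasure SU2 L) =
        qform su2Rep β (fun U => ∑ i, a i * G i U) (fun U => ∑ i, a i * G i U) := fun a => by
    obtain ⟨C, hC⟩ := bounded_combination hfb a
    have h := tubeForm_eq_qform_gaugeAvg β (measurable_combination hfm a) hC
    rw [hcomb a] at h
    exact h
  have hnorm : ∀ a : Fin (k + 1) → ℝ,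
      l2 (fun U => ∑ i, a i * G i U) (fun U => ∑ i, a i * G i U) ≤ ∫ U, (∑ i, a i * f i U) ^ 2 * softWeight (χ β) U ∂configMeasure SU2 L := fun a => by
    obtain ⟨C, hC⟩ := bounded_combination hfb a
    have h := l2_gaugeAvg_le_tubeNormSq (hχm β) hCχ (hχ0 β) hm hmχ (measurable_combination hfm a) hC (hfs' a)
    rw [hcomb a] at h
    exact h
  have hB : 0 ≤ (L : ℝ) ^ 3 * β := by positivity
  have hK : 0 ≤ Real.exp (ε * bareLambda ((L : ℝ) ^ 3 * β)) * levelValue su2Rep 1 ((L : ℝ) ^ 3 * β) k * levelValue su2Rep L β 0 :=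
    mul_nonneg (mul_nonneg (Real.exp_pos _).le (levelValue_su2Rep_nonneg 1 hB k)) (levelValue_zero_su2Rep_pos L β).le
  by_cases hdeg : ∀ a : Fin (k + 1) → ℝ, a ≠ 0 → 0 < l2 (fun U => ∑ i, a i * G i U) (fun U => ∑ i, a i * G i U)
  · -- nondegenerate invariant Gram matrix: INNER applies to `G`
    obtain ⟨a, ha, hle⟩ := hβ0 β hβ0' G hGm hGb hGinv hGs hdeg
    refine ⟨a, ha, ?_⟩
    rw [hform a]
    exact hle.trans (mul_le_mul_of_nonneg_left (hnorm a) hK)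
  · -- degenerate: some nonzero combination has invariant part `0` a.e., hence tube form `0`
    push Not at hdeg
    obtain ⟨a, ha, hle0⟩ := hdeg
    refine ⟨a, ha, ?_⟩
    have hGam : Measurable fun U => ∑ i, a i * G i U := measurable_combination hGm a
    obtain ⟨CG, hCG⟩ := bounded_combination hGb a
    have hint : Integrable (fun U => (∑ i, a i * G i U) * ∑ i, a i * G i U) (configMeasure SU2 L) :=
      integrable_of_measurable_abs_le _ (hGam.mul hGam) (C := CG * CG) fun U => by
        rw [abs_mul]; exact mul_le_mul (hCG U) (hCG U) (abs_nonneg _) ((abs_nonneg _).trans (hCG U))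
    have h0 : (∫ U, (∑ i, a i * G i U) * ∑ i, a i * G i U ∂configMeasure SU2 L) = 0 :=
      le_antisymm hle0 (integral_nonneg fun U => mul_self_nonneg _)
    have hae : ∀ᵐ U ∂configMeasure SU2 L, (∑ i, a i * G i U) = 0 := by
      have h := (integral_eq_zero_iff_of_nonneg (fun U => mul_self_nonneg _) hint).mp h0
      exact h.mono fun U hU => mul_self_eq_zero.mp hU
    have hq0 : qform su2Rep β (fun U => ∑ i, a i * G i U) (fun U => ∑ i, a i * G i U) = 0 := by
      rw [qform_eq_l2_transferApply]
      unfold l2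
      exact integral_eq_zero_of_ae (hae.mono fun U hU => by simp only [hU, zero_mul, Pi.zero_apply])
    rw [hform a, hq0, zero_mul]
    exact mul_nonneg hK (hGram a ha).le

/-! ## §6 ★★ The equivalences by name -/

/-- ★★ **The soft tube statement is INNER one-orbit** for every admissible nonnegative weight bounded below on its support and eventually supported in the
inner region. [cite: Luscher1983, §3] [cite: SeilerLNP1982, §2–3] -/
theorem softTubeNoIntruderAt_iff_inner {δ : ℝ → ℝ} {χ : ℝ → GaugeConfig 3 L SU2 → ℝ} (hadm : SoftTubeAdmissible L δ χ)
    (hχ0 : ∀ β U, 0 ≤ χ β U) (hχlow : ∀ β, ∃ m : ℝ, 0 < m ∧ ∀ U, χ β U ≠ 0 → m ≤ χ β U)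
    (hχs : ∃ β1 : ℝ, ∀ β : ℝ, β1 ≤ β → ∀ U, χ β U ≠ 0 → orbitDist U < δ β) :
    SoftTubeNoIntruderAt L χ ↔ InnerNoIntruderOneOrbitAt L δ :=
  ⟨innerNoIntruderOneOrbitAt_of_softTube hadm, softTubeNoIntruderAt_of_inner hadm.1 hadm.2.1 hχ0 hχlow hχs⟩

/-- The weight of record is nonnegative. [folklore] -/
theorem recordWeight_nonneg (δ δg : ℝ → ℝ) (β : ℝ) (U : GaugeConfig 3 L SU2) : 0 ≤ recordWeight L δ δg β U := by
  unfold recordWeight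
  refine mul_nonneg ?_ (Real.exp_pos _).le
  by_cases h : U ∈ fatTube L δ β <;> simp [h]

/-- Where the weight of record is nonzero the configuration lies in the fat tube. [folklore] -/
theorem mem_fatTube_of_recordWeight_ne_zero (δ δg : ℝ → ℝ) (β : ℝ) {U : GaugeConfig 3 L SU2} (hU : recordWeight L δ δg β U ≠ 0) :
    U ∈ fatTube L δ β := by
  by_contra h
  exact hU (by rw [recordWeight, Set.indicator_of_notMem h, zero_mul])

/-- On its support the weight of record is at least `exp(−|E|/δg²)`. [folklore] -/
theorem recordWeight_ge_of_ne_zero (δ δg : ℝ → ℝ) (β : ℝ) {U : GaugeConfig 3 L SU2} (hU : recordWeight L δ δg β U ≠ 0) :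
    Real.exp (-((Fintype.card (Edge 3 L) : ℝ) / δg β ^ 2)) ≤ recordWeight L δ δg β U := by
  rw [recordWeight, Set.indicator_of_mem (mem_fatTube_of_recordWeight_ne_zero δ δg β hU), one_mul]
  exact gaussFactor_ge L δg β U

/-- The weight of record is supported in the inner region `{orbitDist < δ β}`. [folklore] -/
theorem orbitDist_lt_of_recordWeight_ne_zero (δ δg : ℝ → ℝ) (β : ℝ) {U : GaugeConfig 3 L SU2} (hU : recordWeight L δ δg β U ≠ 0) :
    orbitDist U < δ β :=
  (mem_fatTube_of_recordWeight_ne_zero δ δg β hU).2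

/-- ★★ **C4-CORE's typed interface is INNER one-orbit, at every gauge width**: `SoftTubeNoIntruderAt L (recordWeight L δ δg) ↔ InnerNoIntruderOneOrbitAt L δ`
for all positive `δ` and ALL `δg`. [cite: Luscher1983, §3] -/
theorem softTube_recordWeight_iff_inner {δ : ℝ → ℝ} (hδ : ∀ β, 0 < δ β) (δg : ℝ → ℝ) :
    SoftTubeNoIntruderAt L (recordWeight L δ δg) ↔ InnerNoIntruderOneOrbitAt L δ :=
  softTubeNoIntruderAt_iff_inner (softTubeAdmissible_recordWeight L hδ) (fun β U => recordWeight_nonneg δ δg β U)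
    (fun β => ⟨_, Real.exp_pos _, fun _ hU => recordWeight_ge_of_ne_zero δ δg β hU⟩)
    ⟨0, fun β _ _ hU => orbitDist_lt_of_recordWeight_ne_zero δ δg β hU⟩

/-- ★★ The instance of record: `SoftTubeNoIntruderAt L (recordWeight L (powScale s) (powScale t)) ↔ InnerNoIntruderOneOrbitAt L (powScale s)` — every `s`,
every `t`. [cite: Luscher1983, §3] -/
theorem softTube_recordWeight_pow_iff (s t : ℝ) :
    SoftTubeNoIntruderAt L (recordWeight L (powScale s) (powScale t)) ↔ InnerNoIntruderOneOrbitAt L (powScale s) :=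
  softTube_recordWeight_iff_inner (fun β => powScale_pos s β) (powScale t)

/-- ★ **WIDTH IRRELEVANCE**: the typed statement does not depend on the gauge width at all. [cite: Luscher1983, §3] -/
theorem softTube_recordWeight_width_irrel {δ : ℝ → ℝ} (hδ : ∀ β, 0 < δ β) (δg δg' : ℝ → ℝ) :
    SoftTubeNoIntruderAt L (recordWeight L δ δg) ↔ SoftTubeNoIntruderAt L (recordWeight L δ δg') :=
  (softTube_recordWeight_iff_inner hδ δg).trans (softTube_recordWeight_iff_inner hδ δg').symm

/-- ★ Width irrelevance at the record: gauge width `β^{-t}` versus `β^{-t'}`, any `t, t'`. [cite: Luscher1983, §3] -/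
theorem softTube_recordWeight_pow_width_irrel (s t t' : ℝ) :
    SoftTubeNoIntruderAt L (recordWeight L (powScale s) (powScale t)) ↔ SoftTubeNoIntruderAt L (recordWeight L (powScale s) (powScale t')) :=
  (softTube_recordWeight_pow_iff s t).trans (softTube_recordWeight_pow_iff s t').symm

end Summit.QuantumFields.YangMills.Theorems.TwistedTraceScaling.Negative.R27

end
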